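import Summits.ValiantsHypothesis.ValiantsHypothesis.Theses.PolyaContinued
import Literature.Computability.AlgebraicComplexity.DeterminantalComplexityProofs
import Literature.Combinatorics.SimpleGraph.PerfectMatchingPoly

/-!
# `PolyaContinued.KasteleynDirection` (stmt-ValiantsHypothesis-7425): a Pfaffian bipartite graph
with a perfect matching has `dc(PM_G) = n`

Support item (rank 9) of route `ValiantsHypothesis/PolyaContinued` — the easy ("Kasteleyn")
direction of the affine Little theorem: for `G = E ⊆ Fin n × Fin n` with perfect-matching polynomial
`P = PM_E = per (X (i,j))_{(i,j) ∈ E} ≠ 0`, if some `±1`-signing `s` of the symbolic biadjacency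
matrix has `det (C (s (i,j)) * X (i,j))_{(i,j) ∈ E} = P`, then the determinantal complexity of `P`
is exactly `n`.

## Proof

* `dc P ≤ n`: the signed symbolic matrix is itself an affine determinantal representation of size
  `n` — its entries `C (s e) * X e` and `0` have total degree `≤ 1`
  (`determinantalComplexity_le_of_hasDetRepr`).
* `n ≤ dc P`: `P` is the perfect-matching polynomial `perfectMatchingPoly E ℂ` (by `rfl`,
  `perfectMatchingPoly_eq_permanent`), which is homogeneous of degree `n`, so `P ≠ 0` gives
  `totalDegree P = n` (`totalDegree_perfectMatchingPoly`); and `totalDegree P ≤ dc P`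
  (`totalDegree_le_determinantalComplexity_holds`, Mignon–Ressayre 2004 §1, proved in the tree).

No named fact is assumed; the result is unconditional.

## References

* [MignonRessayre2004] T. Mignon, N. Ressayre, *A quadratic bound for the determinant and permanent
  problem*, IMRN 2004, §1 (`deg ≤ dc`).
* [RobertsonSeymourThomas1999] N. Robertson, P. D. Seymour, R. Thomas, *Permanents, Pfaffian
  orientations, and even directed circuits*, Ann. of Math. 150 (1999), §1 (Pólya matrices).
* P. W. Kasteleyn, *Graph theory and crystal physics* (1967) (signings with `det = PM`).
-/

noncomputable section

-- `Summit.<Summit>.<Problem>` repeats `ValiantsHypothesis` by the tree's layout convention (D-0017).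
set_option linter.dupNamespace false

namespace Summit.ValiantsHypothesis.ValiantsHypothesis.Theorems

open MvPolynomial Literature.Computability.AlgebraicComplexity

/-- The signed symbolic biadjacency matrix `(C (s (i,j)) * X (i,j))_{(i,j) ∈ E}` has affine entries:
every entry has total degree `≤ 1`. [folklore] -/
theorem kasteleynDirection_totalDegree_entry_le {n : ℕ} (E : Finset (Fin n × Fin n))
    (s : Fin n × Fin n → ℂ) (i j : Fin n) :
    ((Matrix.of fun i j => if (i, j) ∈ E then C (s (i, j)) * X (i, j) else 0 :
        Matrix (Fin n) (Fin n) (MvPolynomial (Fin n × Fin n) ℂ)) i j).totalDegree ≤ 1 := by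
  simp only [Matrix.of_apply]
  split_ifs
  · simpa using ((isHomogeneous_C (Fin n × Fin n) (s (i, j))).mul
      (isHomogeneous_X ℂ (i, j))).totalDegree_le
  · simp

/-- A `±1`-signed symbolic biadjacency matrix with `det = P` is an affine determinantal
representation of `P` of size `n`, so `dc P ≤ n` (the signs being `±1` is not even needed).
[folklore] -/
theorem kasteleynDirection_dc_le {n : ℕ} (E : Finset (Fin n × Fin n))
    (P : MvPolynomial (Fin n × Fin n) ℂ) (s : Fin n × Fin n → ℂ)
    (hdet : (Matrix.of fun i j => if (i, j) ∈ E then C (s (i, j)) * X (i, j) else 0 :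
        Matrix (Fin n) (Fin n) (MvPolynomial (Fin n × Fin n) ℂ)).det = P) :
    determinantalComplexity P ≤ n :=
  determinantalComplexity_le_of_hasDetRepr
    ⟨_, kasteleynDirection_totalDegree_entry_le E s, hdet⟩

/-- The perfect-matching polynomial `PM_E = per (X (i,j))_{(i,j) ∈ E}` of a bipartite graph on
`n + n` vertices, when non-zero, has total degree `n` (it is homogeneous of degree `n`); hence
`n ≤ dc (PM_E)` by `deg ≤ dc` (Mignon–Ressayre 2004, §1). [folklore] -/
theorem kasteleynDirection_le_dc {n : ℕ} (E : Finset (Fin n × Fin n))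
    (P : MvPolynomial (Fin n × Fin n) ℂ)
    (hP : P = (Matrix.of fun i j => if (i, j) ∈ E then X (i, j) else 0 :
        Matrix (Fin n) (Fin n) (MvPolynomial (Fin n × Fin n) ℂ)).permanent)
    (hP0 : P ≠ 0) : n ≤ determinantalComplexity P := by
  have hPM : P = Literature.Combinatorics.SimpleGraph.perfectMatchingPoly E ℂ := by
    rw [hP, Literature.Combinatorics.SimpleGraph.perfectMatchingPoly_eq_permanent]
  have hdeg : P.totalDegree = n := by
    rw [hPM] at hP0 ⊢
    simpa using Literature.Combinatorics.SimpleGraph.totalDegree_perfectMatchingPoly hP0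
  calc n = P.totalDegree := hdeg.symm
    _ ≤ determinantalComplexity P := totalDegree_le_determinantalComplexity_holds P

/-- **Support item `PolyaContinued.KasteleynDirection` (stmt-ValiantsHypothesis-7425), proved** —
the easy direction of the affine Little theorem: if `G = E ⊆ K_{n,n}` has a perfect matching
(`PM_E ≠ 0`) and is Pfaffian in the symbolic sense (some `±1`-signing of the symbolic biadjacency
matrix has determinant `PM_E`), then `dc (PM_E) = n`: `≤ n` from the signed matrix (affine entries),
`≥ n` from `totalDegree PM_E = n ≤ dc`. Unconditional. [folklore] -/
theorem kasteleynDirection_proof :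
    Summit.ValiantsHypothesis.ValiantsHypothesis.Theses.PolyaContinued.KasteleynDirection := by
  unfold Summit.ValiantsHypothesis.ValiantsHypothesis.Theses.PolyaContinued.KasteleynDirection
  intro n E P hP hP0 hs
  obtain ⟨s, _, hdet⟩ := hs
  exact le_antisymm (kasteleynDirection_dc_le E P s hdet) (kasteleynDirection_le_dc E P hP hP0)

end Summit.ValiantsHypothesis.ValiantsHypothesis.Theorems

end
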